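import Summits.ValiantsHypothesis.ValiantsHypothesis.Theorems.KPlusLogSqLawTropicalBNewtonPolygon

/-!
# Route «KPlusLogSqLaw», crux `TropicalB` (stmt-ValiantsHypothesis-19771) — the VALUATION-COUNTING law:
# a dominant chain is at most twice the number of attainable valuation sums (uniform in `K`)

HONEST FRAMING.  Helper lemmas toward the registered stub `stub_tropThin` of `Cruxes/TropicalB/Lines/birth.lean` (crux
`Summit.ValiantsHypothesis.ValiantsHypothesis.Theses.KPlusLogSqLaw.TropicalB`, item `stmt-ValiantsHypothesis-19771`, route
`KPlusLogSqLaw`, DRAFT; cell `pub-symmetroid`, seat val-sym-trop-p1 g2).  Third `K`-free size law of the Newton-polygon lane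
(`KPlusLogSqLawTropicalBLatticeChain`, `…NewtonPolygon`, `…NewtonPolygonGauge`): the valuation-side twin of SLOPE COUNTING.  Slope
counting (`tropRow_slopeCount`) bounds a chain by the number `C(m+K−1, m)` of class histograms because the slopes `Σ d(λ i)` strictly
increase; here the valuation sums `Σ v(σ i, i, λ i)` strictly DEcrease and then strictly INcrease along the chain
(`NewtonPolygon.rise_after`), so

* `NewtonPolygon.val_count` (abstract sandwiched lattice chain): if all ordinates lie in a finite set `W` then `n + 1 ≤ 2·#W`;
* `NewtonPolygon.chain_succ_le_valCount`: if the valuation table takes its values in a finite set `Vals ⊂ ℤ` with `#Vals = R`, then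
  `n + 1 ≤ 2·(m+1)^R` (a valuation sum is determined by HOW MANY of the `m` entries of the term carry each value);
* `NewtonPolygon.logSqLaw_of_fewValues`: if `R·(⌊log₂ m⌋ + 1) ≤ c·⌊log₂ m⌋²` then `n ≤ 2^{c·⌊log₂ m⌋² + 1}` — for EVERY `K`.

READING (located necessary condition on hypothetical counterexamples, nothing about `TropicalB` itself): a thin-window monster must
use, for every `c`, more than `c·log₂ m / 2` DISTINCT valuation values eventually (and, by `…NewtonPolygonGauge`, this stays true
for every gauge-and-time-shifted copy `v a b l + F a + G b + t·d l` of its table, since such a copy has the same dominant chain).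
So the valuation table of a monster is rich in three senses at once: spread `> 2^{c log² m}` (`chain_le_valSpread`), jointly with
the exponents `n³ ≤ 24(m·ΔD + 2m·ΔV)²` (`chain_cube_le`), and `> c log m / 2` distinct values (here).  (Calibration: SHIFT-THREE uses
`Θ(m²)` distinct valuation values for its `C(m+2,2) − 1` terms; `2(m+1)^R` is then astronomically loose — the law only bites for
tables with `O(log m)` values.)  Nothing here bears on `TropicalB` / `KPlusLogSqLaw` in the window, on `Lifting`, DoorA26 / DoorA34,
`MatrixDescartes` (`stmt-ValiantsHypothesis-18050`) or VP ≠ VNP.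
-/

-- `Summit.ValiantsHypothesis.ValiantsHypothesis.…` repeats a component by the D-0017 layout
-- (single-conjunct summit), which the `dupNamespace` linter flags; the name is mandated.
set_option linter.dupNamespace false
set_option autoImplicit false

namespace Summit.ValiantsHypothesis.ValiantsHypothesis.Theorems.KPlusLogSqLaw

open Summit.ValiantsHypothesis.ValiantsHypothesis.Theorems.MatrixDescartes.Negative
open scoped BigOperators
open Finset

namespace NewtonPolygon

/-! ## 1. Abstract: ordinates in a finite set -/

section Lattice

variable {n : ℕ} {Θ S C : ℕ → ℤ}

/-- **Ordinate counting** for a sandwiched lattice chain: if every ordinate `C i` (`i ≤ n`) lies in the finite set `W`, then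
`n + 1 ≤ 2·#W` — the ordinates strictly decrease up to the switch index and strictly increase after it, so each of the two parts
injects into `W`. [folklore] -/
theorem val_count (hΘ : ∀ i, i < n → Θ i < Θ (i + 1))
    (hsw : ∀ i, i < n → Θ i * (S (i + 1) - S i) < C (i + 1) - C i ∧
      C (i + 1) - C i < Θ (i + 1) * (S (i + 1) - S i))
    (W : Finset ℤ) (hW : ∀ i, i ≤ n → C i ∈ W) : n + 1 ≤ 2 * W.card := by
  classical
  have hex : ∃ i, n ≤ i ∨ 0 ≤ C (i + 1) - C i := ⟨n, Or.inl le_rfl⟩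
  -- the switch index: the first non-falling edge (or `n`)
  obtain ⟨i₀, hi₀spec, hi₀min⟩ : ∃ i₀, (n ≤ i₀ ∨ 0 ≤ C (i₀ + 1) - C i₀) ∧
      ∀ i, i < i₀ → ¬ (n ≤ i ∨ 0 ≤ C (i + 1) - C i) :=
    ⟨Nat.find hex, Nat.find_spec hex, fun i hi => Nat.find_min hex hi⟩
  have hi₀n : i₀ ≤ n := by
    by_contra h
    push Not at h
    exact hi₀min n h (Or.inl le_rfl)
  have hneg : ∀ i, i < i₀ → C (i + 1) - C i < 0 := fun i hi => by
    have h := hi₀min i hi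
    push Not at h
    exact h.2
  have hpos : ∀ i, i₀ < i → i < n → 0 < C (i + 1) - C i := fun i hi hin => by
    rcases hi₀spec with h | h
    · omega
    · exact rise_after hΘ hsw hi hin h
  -- strict descent on `[0, i₀]`, strict ascent on `[i₀ + 1, n]`
  have hdesc : ∀ i j, i ≤ j → j ≤ i₀ → C j + ((j : ℤ) - i) ≤ C i := by
    intro i j hij hj
    induction j, hij using Nat.le_induction with
    | base => simp
    | succ j hij ih =>
      have h1 := ih (by omega)
      have h2 := hneg j (by omega)
      push_cast
      linarith
  have hasc : ∀ i j, i₀ + 1 ≤ i → i ≤ j → j ≤ n → C i + ((j : ℤ) - i) ≤ C j := by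
    intro i j hi hij hj
    induction j, hij using Nat.le_induction with
    | base => simp
    | succ j hij ih =>
      have h1 := ih (by omega)
      have h2 := hpos j (by omega) (by omega)
      push_cast
      linarith
  -- the two injections into `W`
  have hinj₁ : Set.InjOn C (Finset.range (i₀ + 1) : Set ℕ) := by
    intro i hi j hj h
    simp only [Finset.coe_range, Set.mem_Iio] at hi hj
    by_contra hne
    rcases Nat.lt_or_gt_of_ne hne with hlt | hlt
    · have := hdesc i j hlt.le (by omega)
      have : (0 : ℤ) < (j : ℤ) - i := by
        have : ((i : ℕ) : ℤ) < ((j : ℕ) : ℤ) := by exact_mod_cast hlt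
        linarith
      linarith
    · have := hdesc j i hlt.le (by omega)
      have : (0 : ℤ) < (i : ℤ) - j := by
        have : ((j : ℕ) : ℤ) < ((i : ℕ) : ℤ) := by exact_mod_cast hlt
        linarith
      linarith
  have hinj₂ : Set.InjOn C (Finset.Ico (i₀ + 1) (n + 1) : Set ℕ) := by
    intro i hi j hj h
    simp only [Finset.coe_Ico, Set.mem_Ico] at hi hj
    by_contra hne
    rcases Nat.lt_or_gt_of_ne hne with hlt | hlt
    · have := hasc i j hi.1 hlt.le (by omega)
      have : (0 : ℤ) < (j : ℤ) - i := by
        have : ((i : ℕ) : ℤ) < ((j : ℕ) : ℤ) := by exact_mod_cast hlt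
        linarith
      linarith
    · have := hasc j i hj.1 hlt.le (by omega)
      have : (0 : ℤ) < (i : ℤ) - j := by
        have : ((j : ℕ) : ℤ) < ((i : ℕ) : ℤ) := by exact_mod_cast hlt
        linarith
      linarith
  have h₁ : i₀ + 1 ≤ W.card := by
    have h := Finset.card_le_card_of_injOn C (fun i hi => by
      simp only [Finset.coe_range, Set.mem_Iio] at hi
      exact (hW i (by omega) : C i ∈ W)) hinj₁
    rwa [Finset.card_range] at h
  have h₂ : n - i₀ ≤ W.card := by
    have h := Finset.card_le_card_of_injOn C (fun i hi => by
      simp only [Finset.coe_Ico, Set.mem_Ico] at hi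
      exact (hW i (by omega) : C i ∈ W)) hinj₂
    rw [Nat.card_Ico] at h
    omega
  omega

end Lattice

/-! ## 2. Dominant chains of a design with few valuation values -/

section Design

variable {m K : ℕ} (d : Fin K → ℕ) (v ε : Fin m → Fin m → Fin K → ℤ)

/-- A valuation sum is determined by the counts of each value among the `m` entries of the term, so a valuation table with values
in `Vals` has at most `(m+1)^{#Vals}` distinct valuation sums. [folklore] -/
theorem card_cstValues_le (Vals : Finset ℤ) (hv : ∀ a b l, v a b l ∈ Vals) :
    ∃ W : Finset ℤ, W.card ≤ (m + 1) ^ Vals.card ∧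
      ∀ q : Equiv.Perm (Fin m) × (Fin m → Fin K), IntervalOpt.cst v univ q ∈ W := by
  classical
  refine ⟨(Finset.univ : Finset (Vals → Fin (m + 1))).image
      (fun g => ∑ w : Vals, ((g w : ℕ) : ℤ) * (w : ℤ)), ?_, ?_⟩
  · refine Finset.card_image_le.trans ?_
    rw [Finset.card_univ, Fintype.card_fun, Fintype.card_coe, Fintype.card_fin]
  · intro q
    rw [Finset.mem_image]
    -- the count vector of the term
    refine ⟨fun w => ⟨(univ.filter fun i : Fin m => v (q.1 i) i (q.2 i) = (w : ℤ)).card,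
      Nat.lt_succ_of_le ((Finset.card_filter_le _ _).trans (by rw [Finset.card_univ, Fintype.card_fin]))⟩,
      Finset.mem_univ _, ?_⟩
    -- `Σ_w #(fiber w) · w = Σ_i v_i`
    unfold IntervalOpt.cst
    rw [← Finset.sum_fiberwise_of_maps_to (s := (univ : Finset (Fin m))) (t := Vals)
      (g := fun i : Fin m => v (q.1 i) i (q.2 i)) (fun i _ => hv _ _ _) (fun i : Fin m => v (q.1 i) i (q.2 i))]
    rw [← Finset.sum_coe_sort Vals]
    refine Finset.sum_congr rfl fun w _ => ?_
    have e : ∑ i ∈ univ.filter (fun i : Fin m => v (q.1 i) i (q.2 i) = (w : ℤ)), v (q.1 i) i (q.2 i) =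
        ∑ _i ∈ univ.filter (fun i : Fin m => v (q.1 i) i (q.2 i) = (w : ℤ)), (w : ℤ) :=
      Finset.sum_congr rfl fun i hi => (Finset.mem_filter.1 hi).2
    rw [e, Finset.sum_const, nsmul_eq_mul]

/-- **Valuation-counting law** (`K`-free twin of slope counting): if the valuation table of the design takes its values in a finite
set `Vals`, every chain of pairwise-consecutive-distinct dominant terms at strictly increasing integer slopes has
`n + 1 ≤ 2·(m+1)^{#Vals}`. [folklore] -/
theorem chain_succ_le_valCount (Vals : Finset ℤ) (hv : ∀ a b l, v a b l ∈ Vals) {n : ℕ}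
    (θ : Fin (n + 1) → ℤ) (p : Fin (n + 1) → Equiv.Perm (Fin m) × (Fin m → Fin K)) (hθ : StrictMono θ)
    (hdom : ∀ k, IsDominant d v ε (θ k) (p k)) (hne : ∀ k : Fin n, p k.castSucc ≠ p k.succ) :
    n + 1 ≤ 2 * (m + 1) ^ Vals.card := by
  obtain ⟨Θ, P, hΘ, hdomN, hneN⟩ := exists_natChain d v ε n θ p hθ hdom hne
  obtain ⟨W, hWcard, hW⟩ := card_cstValues_le v Vals hv
  have h := val_count (S := fun i => IntervalOpt.sl d univ (P i)) (C := fun i => IntervalOpt.cst v univ (P i))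
    hΘ (fun i hi => sandwich d v ε hdomN hneN hi) W (fun i _ => hW (P i))
  calc n + 1 ≤ 2 * W.card := h
    _ ≤ 2 * (m + 1) ^ Vals.card := Nat.mul_le_mul_left 2 hWcard

/-- **The `log² m` law on designs with few valuation values, for every `K`**: if the valuation table takes at most `R` distinct
values with `R·(⌊log₂ m⌋ + 1) ≤ c·⌊log₂ m⌋²`, every sign-alternating chain of dominant terms has `n ≤ 2^{c·⌊log₂ m⌋² + 1}`.
So a thin-window counterexample needs more than `c·log₂ m / 2` distinct valuation values, for every `c`, eventually. [folklore] -/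
theorem logSqLaw_of_fewValues (c : ℕ) (Vals : Finset ℤ) (hv : ∀ a b l, v a b l ∈ Vals)
    (hR : Vals.card * (Nat.log 2 m + 1) ≤ c * Nat.log 2 m ^ 2) {n : ℕ}
    (θ : Fin (n + 1) → ℤ) (p : Fin (n + 1) → Equiv.Perm (Fin m) × (Fin m → Fin K)) (hθ : StrictMono θ)
    (hdom : ∀ k, IsDominant d v ε (θ k) (p k))
    (halt : ∀ k : Fin n, termSign ε (p k.castSucc) * termSign ε (p k.succ) < 0) :
    n ≤ 2 ^ (c * Nat.log 2 m ^ 2 + 1) := by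
  -- consecutive terms are distinct (their signs multiply to a negative number)
  have hne : ∀ k : Fin n, p k.castSucc ≠ p k.succ := by
    intro k h
    have := halt k
    rw [h] at this
    exact absurd this (not_lt.mpr (mul_self_nonneg _))
  have h1 := chain_succ_le_valCount d v ε Vals hv θ p hθ hdom hne
  set L := Nat.log 2 m with hL
  have hm : m + 1 ≤ 2 ^ (L + 1) := Nat.lt_pow_succ_log_self (by norm_num) m
  have h2 : (m + 1) ^ Vals.card ≤ 2 ^ ((L + 1) * Vals.card) := by
    rw [pow_mul]
    exact Nat.pow_le_pow_left hm _
  have h3 : (L + 1) * Vals.card ≤ c * L ^ 2 := by rw [mul_comm]; exact hR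
  calc n ≤ 2 * (m + 1) ^ Vals.card := by omega
    _ ≤ 2 * 2 ^ ((L + 1) * Vals.card) := Nat.mul_le_mul_left 2 h2
    _ ≤ 2 * 2 ^ (c * L ^ 2) := Nat.mul_le_mul_left 2 (Nat.pow_le_pow_right (by norm_num) h3)
    _ = 2 ^ (c * L ^ 2 + 1) := by rw [pow_succ]; ring

end Design

end NewtonPolygon

end Summit.ValiantsHypothesis.ValiantsHypothesis.Theorems.KPlusLogSqLaw
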